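import Summits.BirchSwinnertonDyer.BirchSwinnertonDyer.Theorems.AlignedTransportAtTwoMainConjectureTransportAlignedAtTwoKilfordCopyCrossLevelTools
import Summits.BirchSwinnertonDyer.Rank1Residual.F1Sign2.CopyAlignmentAtTwo
import Literature.NumberTheory.EllipticCurves.NewformsOldHeckeStableProofs
import HarnessLib

/-!
# Crux C1 `MainConjectureTransportAlignedAtTwo` (stmt-BirchSwinnertonDyer-22296), line `birth`, residual (R2) `stub_lamLawKilford`, UNEQUAL conductors
# `N₂ = N₁q`: THE OLD-LINE HECKE ROW at the intermediate level — the half-class functional of the `q`-old line `F₁ = ι₁f₁ + q·ι_q f₁` KILLS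
# `𝔪_{f₂}·H₁(X₀(N₂);ℤ)`, i.e. the old `E₁`-plane `D(C₁)` lies in `J₀(N₂)[𝔪_{f₂}]` (width seat att-p3 g18; `--supports 22296`)

THEOREMS ONLY (no `def`, no `sorry`, no named fact). Pure Hecke bookkeeping on `q`-expansions and periods (the tree's `heckeT_iota_of_not_dvd`,
`heckeT_iota_mul`, `heckeT_iota_of_dvd_of_not_dvd` of `NewformsOldHeckeStableProofs`); nothing about Galois representations or the main
conjecture; BSD is not proved by this; C1 is not closed by this.

CONTEXT (memo `Cruxes/…/CROSS-LEVEL-att-p3-g18.md` §4–§5). The intermediate-level reduction (`…KilfordCopyCrossLevel`, p692388) turns the cross-level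
input of (R2) on the shape `N(W₂) = q·N(W₁)` into «same half-kernel at level `N₂` of `(c₁·y(F₁), c₂·y(f₂))`», which att-p4 g17's kernel letter
(`…KilfordKernelLetterOnPoints.ker_iff_ker_of_alignedAtTwo`, abstract `V`, abstract `θ₁ θ₂`) can discharge AT LEVEL `N₂` once its rows hold for the
old-line map `θ₁`. One row is «`θ₁` kills `U^⊥`», `U = J₀(N₂)[𝔪_{f₂}]`, whose Hecke half — the analogue of att-p4 g17's
`…KilfordKernelLetterHecke.jacobiMap_half_smul_eq_zero_of_mem_modTwoHeckeIdeal` for the newform — is, for the OLD LINE, the statement of this file: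

* §1 the old basis `b₁ = ι₁ f₁`, `b₂ = q·ι_q f₁` of the `f₁`-old part of `S₂(Γ₀(N₂))` and the Hecke action on it: `T_p bᵢ = a_p(f₁) bᵢ` (`p ≠ q`),
  `U_q b₁ = a_q(f₁) b₁ − b₂`, `U_q b₂ = q b₁` (the matrix `[[a_q, q], [−1, 0]]`, mod `2` the SWAP); integrality `c₁·y(bᵢ) ∈ Λ₁`.
* §2 **`exists_oldBasis_action`** — adjoin induction over `𝕋(N₂) = ℤ[T_p]`: every `t` acts on `(b₁, b₂)` by an integer matrix `≡ [[x, y], [y, x]] (mod 2)`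
  with `x + y ≡ λ_{f₂}(t)` (generators: `a_p(f₁) ≡ a_p(f₂)` for `p ≠ q`; at `q`: `a_q(f₁)` even, `q` odd, `a_q(f₂)` odd).
* §3 **`oldLine_half_smul_mem`** — for `t ∈ 𝔪_{f₂} = F1Sign2.modTwoHeckeIdeal f₂` and `y ∈ H₁(X₀(N₂);ℤ)`: `c₁·(t•y)(F₁)/2 ∈ Λ₁` (`F₁ = b₁ + b₂`,
  `Λ₁ ⊇ c₁Λ_{f₁}`), with its coset form — «the old-line half-class functional is constant on `𝔪_{f₂}`-cosets», the kernel form of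
  `D(C₁) ⊆ J₀(N₂)[𝔪_{f₂}]` (census att-p5 g18: `dim J₀(N₂)[𝔪₂] = 4` with `D(C₁)` inside, 17/17 levels).

References: Diamond–Shurman GTM 228 Prop. 5.6.2 [DiamondShurman2005]; Darmon–Diamond–Taylor 1995 §1.3, §4.1 [DarmonDiamondTaylor1995]; Cremona 1997 §2.4,
§2.10 [CremonaAlgorithms1997]; Ribet 1990 (level raising at `q` with `a_q ≡ ±(q+1)`) for the reading [Ribet1990Raising].
-/

noncomputable section

-- justification: the `Summit.BirchSwinnertonDyer.BirchSwinnertonDyer.…` path repeats a component (route-file convention)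
set_option linter.dupNamespace false
set_option autoImplicit false

open scoped MatrixGroups ModularForm Classical

open CongruenceSubgroup Complex
open Literature.NumberTheory.EllipticCurves Literature.NumberTheory.EllipticCurves.ModularForms
open Summit.BirchSwinnertonDyer.Rank1Residual.F1Sign2
open Summit.BirchSwinnertonDyer.BirchSwinnertonDyer.Theorems.AlignedTransportAtTwoKilfordCopyCrossLevelTools
open Summit.BirchSwinnertonDyer.BirchSwinnertonDyer.Theorems.MazurTateCongruenceAtTwoR.DepletedLattice (modularSymbol_iota)

namespace Summit.BirchSwinnertonDyer.BirchSwinnertonDyer.Theorems.AlignedTransportAtTwoKilfordCopyCrossLevelHecke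

/-! ## §1 The old basis `b₁ = ι₁ f₁`, `b₂ = q·ι_q f₁` at level `N₂`: Hecke action and integrality of periods -/

section OldBasis

/-- `ι_d` only depends on `d` (re-indexing along `d = d'`). [folklore] -/
theorem iota_congr_index {N₁ N₂ : ℕ} {d d' : ℕ} [NeZero d] [NeZero d'] (hdd : d = d') (h : N₁ * d ∣ N₂) (h' : N₁ * d' ∣ N₂)
    (g : CuspForm (Gamma0 N₁) 2) : iota N₁ N₂ d 2 h g = iota N₁ N₂ d' 2 h' g := by
  subst hdd; rfl

/-- `T_p b₁ = a_p(f₁) b₁` for `p ≠ q` (`b₁ = ι₁ f₁`; `T_p` commutes with `ι₁`, both levels see the same `p`). [cite: DiamondShurman2005, Prop. 5.6.2] -/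
theorem heckeT_iota_one_of_ne {N₁ N₂ : ℕ} [NeZero N₁] [NeZero N₂] {q : ℕ} (hN₂ : N₂ = N₁ * q) (hq : q.Prime) (h₁ : N₁ * 1 ∣ N₂) (f₁ : CuspForm (Gamma0 N₁) 2)
    {p : ℕ} (hp : p.Prime) (hpq : p ≠ q)
    (hT₁ : (haveI : NeZero p := ⟨hp.ne_zero⟩; heckeT (Gamma0 N₁) 2 p f₁) = cuspCoeff f₁ p • f₁) :
    (haveI : NeZero p := ⟨hp.ne_zero⟩; heckeT (Gamma0 N₂) 2 p (iota N₁ N₂ 1 2 h₁ f₁)) = cuspCoeff f₁ p • iota N₁ N₂ 1 2 h₁ f₁ := by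
  haveI : NeZero p := ⟨hp.ne_zero⟩
  have hMN : p ∣ N₁ ↔ p ∣ N₂ := by
    rw [hN₂]
    refine ⟨fun h ↦ h.mul_right q, fun h ↦ ?_⟩
    rcases (Nat.Prime.dvd_mul hp).mp h with h | h
    · exact h
    · exact absurd ((Nat.prime_dvd_prime_iff_eq hp hq).mp h) hpq
  rw [heckeT_iota_of_not_dvd h₁ hp (fun h ↦ hp.ne_one (Nat.dvd_one.mp h)) hMN, hT₁, map_smul]

/-- `T_p (ι_q f₁) = a_p(f₁) ι_q f₁` for `p ≠ q`. [cite: DiamondShurman2005, Prop. 5.6.2] -/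
theorem heckeT_iota_q_of_ne {N₁ N₂ : ℕ} [NeZero N₁] [NeZero N₂] {q : ℕ} [NeZero q] (hN₂ : N₂ = N₁ * q) (hq : q.Prime) (hq' : N₁ * q ∣ N₂) (f₁ : CuspForm (Gamma0 N₁) 2)
    {p : ℕ} (hp : p.Prime) (hpq : p ≠ q)
    (hT₁ : (haveI : NeZero p := ⟨hp.ne_zero⟩; heckeT (Gamma0 N₁) 2 p f₁) = cuspCoeff f₁ p • f₁) :
    (haveI : NeZero p := ⟨hp.ne_zero⟩; heckeT (Gamma0 N₂) 2 p (iota N₁ N₂ q 2 hq' f₁)) = cuspCoeff f₁ p • iota N₁ N₂ q 2 hq' f₁ := by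
  haveI : NeZero p := ⟨hp.ne_zero⟩
  have hMN : p ∣ N₁ ↔ p ∣ N₂ := by
    rw [hN₂]
    refine ⟨fun h ↦ h.mul_right q, fun h ↦ ?_⟩
    rcases (Nat.Prime.dvd_mul hp).mp h with h | h
    · exact h
    · exact absurd ((Nat.prime_dvd_prime_iff_eq hp hq).mp h) hpq
  rw [heckeT_iota_of_not_dvd hq' hp (fun h ↦ hpq ((Nat.prime_dvd_prime_iff_eq hp hq).mp h)) hMN, hT₁, map_smul]

/-- `U_q b₁ = a_q(f₁) b₁ − q·ι_q f₁` (`q ∣ N₂`, `q ∤ N₁`: the first column `(T_q, −1)` of the level-raising matrix). [cite: DiamondShurman2005, Prop. 5.6.2] -/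
theorem heckeT_q_iota_one {N₁ N₂ : ℕ} [NeZero N₁] [NeZero N₂] {q : ℕ} [NeZero q] (hN₂ : N₂ = N₁ * q) (hq : q.Prime) (hqN₁ : ¬ q ∣ N₁) (h₁ : N₁ * 1 ∣ N₂) (hq' : N₁ * q ∣ N₂)
    (f₁ : CuspForm (Gamma0 N₁) 2) (hT₁ : heckeT (Gamma0 N₁) 2 q f₁ = cuspCoeff f₁ q • f₁) :
    heckeT (Gamma0 N₂) 2 q (iota N₁ N₂ 1 2 h₁ f₁) = cuspCoeff f₁ q • iota N₁ N₂ 1 2 h₁ f₁ - (q : ℂ) • iota N₁ N₂ q 2 hq' f₁ := by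
  have hqN₂ : q ∣ N₂ := by rw [hN₂]; exact Dvd.intro_left _ rfl
  have h2 : N₁ * (1 * q) ∣ N₂ := by rw [one_mul]; exact hq'
  rw [heckeT_iota_of_dvd_of_not_dvd h₁ h2 hq hqN₂ hqN₁ (fun h ↦ hq.ne_one (Nat.dvd_one.mp h)), hT₁, map_smul,
    iota_congr_index (one_mul q) h2 hq']
  norm_num

/-- `U_q (ι_q f₁) = ι₁ f₁` (`U_q ι_q = 1`). [cite: DiamondShurman2005, Prop. 5.6.2] -/
theorem heckeT_q_iota_q {N₁ N₂ : ℕ} [NeZero N₁] [NeZero N₂] {q : ℕ} [NeZero q] (hN₂ : N₂ = N₁ * q) (hq : q.Prime) (h₁ : N₁ * 1 ∣ N₂) (hq' : N₁ * q ∣ N₂) (f₁ : CuspForm (Gamma0 N₁) 2) :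
    heckeT (Gamma0 N₂) 2 q (iota N₁ N₂ q 2 hq' f₁) = iota N₁ N₂ 1 2 h₁ f₁ := by
  have hqN₂ : q ∣ N₂ := by rw [hN₂]; exact Dvd.intro_left _ rfl
  have h2 : N₁ * (q * 1) ∣ N₂ := by rw [mul_one]; exact hq'
  rw [iota_congr_index (mul_one q).symm hq' h2, heckeT_iota_mul h2 h₁ hq hqN₂]

/-- The old line in the old basis: `a_n(F₁) = a_n(f₁) + q·a_{n/q}(f₁)` means `F₁ = ι₁ f₁ + q·ι_q f₁`. [cite: DiamondShurman2005, §5.7] -/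
theorem oldLine_eq {N₁ N₂ : ℕ} {q : ℕ} [NeZero q] (h₁ : N₁ * 1 ∣ N₂) (hq' : N₁ * q ∣ N₂) (f₁ : CuspForm (Gamma0 N₁) 2) (F₁ : CuspForm (Gamma0 N₂) 2)
    (hF₁ : ∀ n : ℕ, cuspCoeff F₁ n = cuspCoeff f₁ n + (q : ℂ) * (if q ∣ n then cuspCoeff f₁ (n / q) else 0)) :
    F₁ = iota N₁ N₂ 1 2 h₁ f₁ + (q : ℂ) • iota N₁ N₂ q 2 hq' f₁ := by
  refine eq_of_forall_cuspCoeff_eq_gamma0 fun n ↦ ?_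
  rw [hF₁ n]
  simp only [cuspCoeff, qExpansion_coeff_add_level0, qExpansion_coeff_smul, qExpansion_coeff_iota, one_dvd, if_true, Nat.div_one]

/-- **Integrality of the old periods**: for `y ∈ H₁(X₀(N₂);ℤ)`, `c₁·y(ι₁ f₁) ∈ Λ₁` and `c₁·y(q·ι_q f₁) ∈ Λ₁` (`{∞, γ∞}_{ι_d f₁} = d⁻¹{∞, d·γ∞}_{f₁}` and
`d·γ∞` is a `Γ₀(N₁)`-translate of `∞` for `N₁d ∣ N₂`). [cite: CremonaAlgorithms1997, §2.4] -/
theorem mul_apply_oldBasis_mem {N₁ N₂ : ℕ} [NeZero N₂] {q : ℕ} [NeZero q] (h₁ : N₁ * 1 ∣ N₂) (hq' : N₁ * q ∣ N₂) (f₁ : CuspForm (Gamma0 N₁) 2)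
    (Λ₁ : AddSubgroup ℂ) (c₁ : ℂ) (hc₁ : ∀ z ∈ periodLattice f₁, c₁ * z ∈ Λ₁)
    {y : Module.Dual ℂ (CuspForm (Gamma0 N₂) 2)} (hy : y ∈ periodHomology N₂) :
    c₁ * y (iota N₁ N₂ 1 2 h₁ f₁) ∈ Λ₁ ∧ c₁ * y ((q : ℂ) • iota N₁ N₂ q 2 hq' f₁) ∈ Λ₁ := by
  have hy' : y ∈ (periodHomology N₂ : Set (Module.Dual ℂ (CuspForm (Gamma0 N₂) 2))) := hy
  rw [coe_periodHomology_eq_range] at hy'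
  obtain ⟨γ, rfl⟩ := hy'
  rw [map_smul, periodFunctional_apply, periodFunctional_apply, smul_eq_mul]
  by_cases hγ : (γ : SL(2, ℤ)) 1 0 = 0
  · simp only [cuspSymbol, if_pos hγ, mul_zero, Λ₁.zero_mem, and_self]
  have hq0 : (q : ℂ) ≠ 0 := by exact_mod_cast NeZero.ne q
  have key : ∀ (d : ℕ) [NeZero d] (hd : N₁ * d ∣ N₂), c₁ * ((d : ℂ) * cuspSymbol (iota N₁ N₂ d 2 hd f₁) γ) ∈ Λ₁ := by
    intro d _ hd
    obtain ⟨δ, hδ, hδr⟩ := exists_gamma0_dilate_cusp (NeZero.ne d) hd γ hγ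
    have hd0 : (d : ℂ) ≠ 0 := by exact_mod_cast NeZero.ne d
    have h : cuspSymbol f₁ δ = modularSymbol f₁ ((d : ℚ) * ((((γ : SL(2, ℤ)) 0 0 : ℚ) / ((γ : SL(2, ℤ)) 1 0 : ℚ)))) := by
      rw [cuspSymbol, if_neg hδ, hδr]
    rw [cuspSymbol, if_neg hγ, modularSymbol_iota, ← mul_assoc (d : ℂ), mul_inv_cancel₀ hd0, one_mul, ← h]
    exact hc₁ _ (cuspSymbol_mem_periodLattice f₁ δ)
  refine ⟨?_, key q hq'⟩
  simpa only [Nat.cast_one, one_mul] using key 1 h₁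

end OldBasis

/-! ## §2 The Hecke ring of level `N₂` on the old basis: an integer matrix `≡ [[x, y], [y, x]]` with `x + y ≡ λ_{f₂}` (mod 2) -/

section Action

/-- The parity bookkeeping of the product of two matrices `[[α, γ], [β, δ]] ≡ [[x, y], [y, x]]`, `x + y ≡ m` (mod 2). [folklore] -/
theorem parity_mul (α β γ δ m α' β' γ' δ' m' : ℤ) (h₁ : (2 : ℤ) ∣ α - δ) (h₂ : (2 : ℤ) ∣ β - γ) (h₃ : (2 : ℤ) ∣ α + β - m)
    (h₁' : (2 : ℤ) ∣ α' - δ') (h₂' : (2 : ℤ) ∣ β' - γ') (h₃' : (2 : ℤ) ∣ α' + β' - m') :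
    (2 : ℤ) ∣ (α * α' + β * γ') - (γ * β' + δ * δ') ∧ (2 : ℤ) ∣ (α * β' + β * δ') - (γ * α' + δ * γ') ∧
      (2 : ℤ) ∣ (α * α' + β * γ') + (α * β' + β * δ') - m * m' := by
  obtain ⟨a, ha⟩ := h₁; obtain ⟨b, hb⟩ := h₂; obtain ⟨c, hc⟩ := h₃
  obtain ⟨a', ha'⟩ := h₁'; obtain ⟨b', hb'⟩ := h₂'; obtain ⟨c', hc'⟩ := h₃'
  refine ⟨⟨a * δ' + a' * δ + 2 * a * a' + b * γ' - γ * b', by linear_combination α' * ha + (δ + 2 * a) * ha' + γ' * hb - γ * hb'⟩,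
    ⟨δ * b' + a * γ' + 2 * a * b' + b * δ' - γ * a', by linear_combination β' * ha + (δ + 2 * a) * hb' + δ' * hb - γ * ha'⟩,
    ⟨-β * b' - β * a' + c * (α' + β') + c' * (α + β) - 2 * c * c', by
      linear_combination (-β) * hb' + (-β) * ha' + (α + β - 2 * c) * hc' + m' * hc⟩⟩

/-- **The Hecke ring `𝕋(N₂)` on the old basis.** `N₂ = N₁q`, `q ∤ N₁` prime; `f₁ ∈ S₂(Γ₀(N₁))`, `f₂ ∈ S₂(Γ₀(N₂))` eigenforms for every `T_p` with
integer eigenvalues `A₁`, `A₂`, congruent mod `2` at every prime `p ≠ q`, `A₁(q)` even, `A₂(q)` and `q` odd. Then every `t ∈ 𝕋(N₂)` acts on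
`b₁ = ι₁f₁`, `b₂ = q·ι_qf₁` by integers `t b₁ = αb₁ + βb₂`, `t b₂ = γb₁ + δb₂` and on `f₂` by an integer `m`, with `α ≡ δ`, `β ≡ γ`, `α + β ≡ m`
(mod 2) — i.e. `t ≡ x + y·u` on the old lattice, `u = U_q mod 2` the swap, `x + y ≡ λ_{f₂}(t)`. [cite: DiamondShurman2005, Prop. 5.6.2]
[cite: DarmonDiamondTaylor1995, §4.1 Lemma 4.1 (a)] -/
theorem exists_oldBasis_action {N₁ N₂ : ℕ} [NeZero N₁] [NeZero N₂] {q : ℕ} [NeZero q] (hN₂ : N₂ = N₁ * q) (hq : q.Prime) (hqN₁ : ¬ q ∣ N₁) (hqodd : Odd q)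
    (h₁ : N₁ * 1 ∣ N₂) (hq' : N₁ * q ∣ N₂)
    (f₁ : CuspForm (Gamma0 N₁) 2) (f₂ : CuspForm (Gamma0 N₂) 2) (A₁ A₂ : ℕ → ℤ)
    (hA₁ : ∀ n, cuspCoeff f₁ n = A₁ n) (hA₂ : ∀ n, cuspCoeff f₂ n = A₂ n)
    (hT₁ : ∀ (p : ℕ) (hp : p.Prime), (haveI : NeZero p := ⟨hp.ne_zero⟩; heckeT (Gamma0 N₁) 2 p f₁) = cuspCoeff f₁ p • f₁)
    (hT₂ : ∀ (p : ℕ) (hp : p.Prime), (haveI : NeZero p := ⟨hp.ne_zero⟩; heckeT (Gamma0 N₂) 2 p f₂) = cuspCoeff f₂ p • f₂)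
    (hAq₁ : Even (A₁ q)) (hAq₂ : Odd (A₂ q)) (hA : ∀ p : ℕ, p.Prime → p ≠ q → (2 : ℤ) ∣ A₁ p - A₂ p)
    (t : HeckeRing0 N₂ 2) :
    ∃ α β γ δ m : ℤ,
      HeckeRing0.toEnd N₂ 2 t (iota N₁ N₂ 1 2 h₁ f₁) = (α : ℂ) • iota N₁ N₂ 1 2 h₁ f₁ + (β : ℂ) • ((q : ℂ) • iota N₁ N₂ q 2 hq' f₁) ∧
      HeckeRing0.toEnd N₂ 2 t ((q : ℂ) • iota N₁ N₂ q 2 hq' f₁) =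
        (γ : ℂ) • iota N₁ N₂ 1 2 h₁ f₁ + (δ : ℂ) • ((q : ℂ) • iota N₁ N₂ q 2 hq' f₁) ∧
      HeckeRing0.toEnd N₂ 2 t f₂ = (m : ℂ) • f₂ ∧
      (2 : ℤ) ∣ α - δ ∧ (2 : ℤ) ∣ β - γ ∧ (2 : ℤ) ∣ α + β - m := by
  set b₁ := iota N₁ N₂ 1 2 h₁ f₁ with hb₁
  set b₂ := (q : ℂ) • iota N₁ N₂ q 2 hq' f₁ with hb₂
  rw [HeckeRing0.toEnd_apply]
  suffices h : ∀ s : Module.End ℂ (CuspForm (Gamma0 N₂) 2), s ∈ heckeRing0 N₂ 2 → ∃ α β γ δ m : ℤ,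
      s b₁ = (α : ℂ) • b₁ + (β : ℂ) • b₂ ∧ s b₂ = (γ : ℂ) • b₁ + (δ : ℂ) • b₂ ∧ s f₂ = (m : ℂ) • f₂ ∧
      (2 : ℤ) ∣ α - δ ∧ (2 : ℤ) ∣ β - γ ∧ (2 : ℤ) ∣ α + β - m from h _ (HeckeRing0.toSubalgebra N₂ 2 t).2
  intro s hs
  change s ∈ Algebra.adjoin ℤ (heckeRing0Generators N₂ 2) at hs
  induction hs using Algebra.adjoin_induction with
  | mem x hx =>
    obtain ⟨p, hp, rfl⟩ := hx
    haveI : NeZero p := ⟨hp.ne_zero⟩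
    by_cases hpq : p = q
    · subst hpq
      refine ⟨A₁ p, -1, p, 0, A₂ p, ?_, ?_, ?_, ?_, ?_, ?_⟩
      · rw [hb₁, heckeT_q_iota_one hN₂ hq hqN₁ h₁ hq' f₁ (hT₁ p hp), hA₁, hb₂]
        simp only [Int.cast_neg, Int.cast_one, neg_smul, one_smul, sub_eq_add_neg]
      · rw [hb₂, map_smul, heckeT_q_iota_q hN₂ hq h₁ hq' f₁, Int.cast_natCast, Int.cast_zero, zero_smul, add_zero]
      · rw [hT₂ p hp, hA₂]
      · simpa using hAq₁.two_dvd
      · obtain ⟨k, hk⟩ := hqodd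
        exact ⟨-(k : ℤ) - 1, by push_cast [hk]; ring⟩
      · have h1 := hAq₁.two_dvd
        have h2 : (2 : ℤ) ∣ A₂ p - 1 := by
          obtain ⟨k, hk⟩ := hAq₂
          exact ⟨k, by rw [hk]; ring⟩
        have : A₁ p + -1 - A₂ p = A₁ p - (A₂ p - 1) - 2 := by ring
        rw [this]
        exact dvd_sub (dvd_sub h1 h2) (dvd_refl 2)
    · refine ⟨A₁ p, 0, 0, A₁ p, A₂ p, ?_, ?_, ?_, ?_, ?_, ?_⟩
      · rw [hb₁, heckeT_iota_one_of_ne hN₂ hq h₁ f₁ hp hpq (hT₁ p hp), hA₁, Int.cast_zero, zero_smul, add_zero]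
      · rw [hb₂, map_smul, heckeT_iota_q_of_ne hN₂ hq hq' f₁ hp hpq (hT₁ p hp), hA₁, Int.cast_zero, zero_smul, zero_add, smul_comm]
      · rw [hT₂ p hp, hA₂]
      · simp
      · simp
      · simpa using hA p hp hpq
  | algebraMap r =>
    have hr : ∀ v : CuspForm (Gamma0 N₂) 2, (algebraMap ℤ (Module.End ℂ (CuspForm (Gamma0 N₂) 2)) r) v = (r : ℂ) • v :=
      fun v ↦ by rw [Algebra.algebraMap_eq_smul_one, LinearMap.smul_apply, Module.End.one_apply, Int.cast_smul_eq_zsmul]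
    refine ⟨r, 0, 0, r, r, ?_, ?_, hr f₂, by simp, by simp, by simp⟩
    · rw [hr, Int.cast_zero, zero_smul, add_zero]
    · rw [hr, Int.cast_zero, zero_smul, zero_add]
  | add x y _ _ hx hy =>
    obtain ⟨α, β, γ, δ, m, h1, h2, h3, p1, p2, p3⟩ := hx
    obtain ⟨α', β', γ', δ', m', h1', h2', h3', p1', p2', p3'⟩ := hy
    refine ⟨α + α', β + β', γ + γ', δ + δ', m + m', ?_, ?_, ?_, ?_, ?_, ?_⟩
    · rw [LinearMap.add_apply, h1, h1']; push_cast; module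
    · rw [LinearMap.add_apply, h2, h2']; push_cast; module
    · rw [LinearMap.add_apply, h3, h3', Int.cast_add, add_smul]
    · have : α + α' - (δ + δ') = (α - δ) + (α' - δ') := by ring
      rw [this]; exact dvd_add p1 p1'
    · have : β + β' - (γ + γ') = (β - γ) + (β' - γ') := by ring
      rw [this]; exact dvd_add p2 p2'
    · have : α + α' + (β + β') - (m + m') = (α + β - m) + (α' + β' - m') := by ring
      rw [this]; exact dvd_add p3 p3'
  | mul x y _ _ hx hy =>
    -- `(x * y) v = x (y v)`: the matrix of `x ∘ y`
    obtain ⟨α', β', γ', δ', m', h1', h2', h3', p1', p2', p3'⟩ := hx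
    obtain ⟨α, β, γ, δ, m, h1, h2, h3, p1, p2, p3⟩ := hy
    obtain ⟨q1, q2, q3⟩ := parity_mul α β γ δ m α' β' γ' δ' m' p1 p2 p3 p1' p2' p3'
    refine ⟨α * α' + β * γ', α * β' + β * δ', γ * α' + δ * γ', γ * β' + δ * δ', m * m', ?_, ?_, ?_, q1, q2, q3⟩
    · rw [Module.End.mul_apply, h1, map_add, map_smul, map_smul, h1', h2']; push_cast; module
    · rw [Module.End.mul_apply, h2, map_add, map_smul, map_smul, h1', h2']; push_cast; module
    · rw [Module.End.mul_apply, h3, map_smul, h3', smul_smul, Int.cast_mul, mul_comm]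

end Action

/-! ## §3 The old-line half-class functional kills `𝔪_{f₂}·H₁(X₀(N₂);ℤ)` -/

section Row

/-- **THE OLD-LINE HECKE ROW.** In the setting of `exists_oldBasis_action`, with `f₂ ≠ 0`, the old line `F₁` (`a_n(F₁) = a_n(f₁) + q a_{n/q}(f₁)`) and a
lattice `Λ₁ ⊇ c₁Λ_{f₁}`: for every `t ∈ 𝔪_{f₂} = Ann(f₂) + 2𝕋(N₂)` and `y ∈ H₁(X₀(N₂);ℤ)`, `c₁·(t•y)(F₁)/2 ∈ Λ₁`. Reason: `t = s + 2r` with `s f₂ = 0`,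
so `s` acts on the old lattice as `[[x, y], [y, x]]` with `x + y` even, whence `s(b₁ + b₂) = (x+y)(b₁ + b₂) ∈ 2·(ℤb₁ + ℤb₂)` modulo `2`; and
`c₁·y(bᵢ) ∈ Λ₁`. This is the Hecke half of the row «`θ₁` kills `U^⊥`» for the old-line map in the kernel letter at level `N₂`.
[cite: DiamondShurman2005, Prop. 5.6.2] [cite: DarmonDiamondTaylor1995, §1.3 and §4.1] [cite: CremonaAlgorithms1997, §2.10] -/
theorem oldLine_half_smul_mem {N₁ N₂ : ℕ} [NeZero N₁] [NeZero N₂] {q : ℕ} [NeZero q] (hN₂ : N₂ = N₁ * q) (hq : q.Prime) (hqN₁ : ¬ q ∣ N₁) (hqodd : Odd q)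
    (f₁ : CuspForm (Gamma0 N₁) 2) (f₂ : CuspForm (Gamma0 N₂) 2) (hf₂ : f₂ ≠ 0) (A₁ A₂ : ℕ → ℤ)
    (hA₁ : ∀ n, cuspCoeff f₁ n = A₁ n) (hA₂ : ∀ n, cuspCoeff f₂ n = A₂ n)
    (hT₁ : ∀ (p : ℕ) (hp : p.Prime), (haveI : NeZero p := ⟨hp.ne_zero⟩; heckeT (Gamma0 N₁) 2 p f₁) = cuspCoeff f₁ p • f₁)
    (hT₂ : ∀ (p : ℕ) (hp : p.Prime), (haveI : NeZero p := ⟨hp.ne_zero⟩; heckeT (Gamma0 N₂) 2 p f₂) = cuspCoeff f₂ p • f₂)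
    (hAq₁ : Even (A₁ q)) (hAq₂ : Odd (A₂ q)) (hA : ∀ p : ℕ, p.Prime → p ≠ q → (2 : ℤ) ∣ A₁ p - A₂ p)
    (F₁ : CuspForm (Gamma0 N₂) 2)
    (hF₁ : ∀ n : ℕ, cuspCoeff F₁ n = cuspCoeff f₁ n + (q : ℂ) * (if q ∣ n then cuspCoeff f₁ (n / q) else 0))
    (Λ₁ : AddSubgroup ℂ) (c₁ : ℂ) (hc₁ : ∀ z ∈ periodLattice f₁, c₁ * z ∈ Λ₁)
    {t : HeckeRing0 N₂ 2} (ht : t ∈ modTwoHeckeIdeal f₂) (y : periodHomologyHecke N₂) :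
    c₁ * ((t • y : periodHomologyHecke N₂) : Module.Dual ℂ (CuspForm (Gamma0 N₂) 2)) F₁ / 2 ∈ Λ₁ := by
  have h₁ : N₁ * 1 ∣ N₂ := by rw [mul_one, hN₂]; exact Dvd.intro _ rfl
  have hq' : N₁ * q ∣ N₂ := by rw [hN₂]
  have hF := oldLine_eq h₁ hq' f₁ F₁ hF₁
  -- integrality of the old periods for any cycle
  have hint : ∀ z : periodHomologyHecke N₂,
      c₁ * (z : Module.Dual ℂ (CuspForm (Gamma0 N₂) 2)) (iota N₁ N₂ 1 2 h₁ f₁) ∈ Λ₁ ∧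
        c₁ * (z : Module.Dual ℂ (CuspForm (Gamma0 N₂) 2)) ((q : ℂ) • iota N₁ N₂ q 2 hq' f₁) ∈ Λ₁ :=
    fun z ↦ mul_apply_oldBasis_mem h₁ hq' f₁ Λ₁ c₁ hc₁ z.2
  -- `t = s + r`, `s ∈ Ann(f₂)`, `r ∈ 2𝕋`
  obtain ⟨s, hs, r, hr, rfl⟩ := Submodule.mem_sup.mp ht
  rw [Ideal.mem_span_singleton'] at hr
  obtain ⟨a, rfl⟩ := hr
  -- the `Ann(f₂)`-part: `s (b₁ + b₂) = (α + γ) b₁ + (β + δ) b₂` with both coefficients even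
  obtain ⟨α, β, γ, δ, m, e1, e2, e3, p1, p2, p3⟩ :=
    exists_oldBasis_action hN₂ hq hqN₁ hqodd h₁ hq' f₁ f₂ A₁ A₂ hA₁ hA₂ hT₁ hT₂ hAq₁ hAq₂ hA s
  have hsf : HeckeRing0.toEnd N₂ 2 s f₂ = 0 := hs
  have hm : m = 0 := by
    rw [e3] at hsf
    rcases smul_eq_zero.mp hsf with h | h
    · exact_mod_cast h
    · exact absurd h hf₂
  subst hm
  obtain ⟨k₁, hk₁⟩ : (2 : ℤ) ∣ α + γ := by
    have : α + γ = (α + β - 0) - (β - γ) := by ring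
    rw [this]; exact dvd_sub p3 p2
  obtain ⟨k₂, hk₂⟩ : (2 : ℤ) ∣ β + δ := by
    have : β + δ = (α + β - 0) - (α - δ) := by ring
    rw [this]; exact dvd_sub p3 p1
  have hsF : HeckeRing0.toEnd N₂ 2 s F₁ =
      ((2 * k₁ : ℤ) : ℂ) • iota N₁ N₂ 1 2 h₁ f₁ + ((2 * k₂ : ℤ) : ℂ) • ((q : ℂ) • iota N₁ N₂ q 2 hq' f₁) := by
    rw [hF, map_add, e1, e2, ← hk₁, ← hk₂]; push_cast; module
  -- evaluate `(t•y)(F₁)`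
  have hay : ((a * 2 : HeckeRing0 N₂ 2) • y) = a • y + a • y := by rw [mul_comm, mul_smul, two_smul]
  have hFa : ((a • y : periodHomologyHecke N₂) : Module.Dual ℂ (CuspForm (Gamma0 N₂) 2)) F₁ =
      ((a • y : periodHomologyHecke N₂) : Module.Dual ℂ (CuspForm (Gamma0 N₂) 2)) (iota N₁ N₂ 1 2 h₁ f₁) +
        ((a • y : periodHomologyHecke N₂) : Module.Dual ℂ (CuspForm (Gamma0 N₂) 2)) ((q : ℂ) • iota N₁ N₂ q 2 hq' f₁) := by
    rw [hF, map_add]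
  have hval : (((s + a * 2) • y : periodHomologyHecke N₂) : Module.Dual ℂ (CuspForm (Gamma0 N₂) 2)) F₁ =
      ((2 * k₁ : ℤ) : ℂ) * (y : Module.Dual ℂ (CuspForm (Gamma0 N₂) 2)) (iota N₁ N₂ 1 2 h₁ f₁) +
        ((2 * k₂ : ℤ) : ℂ) * (y : Module.Dual ℂ (CuspForm (Gamma0 N₂) 2)) ((q : ℂ) • iota N₁ N₂ q 2 hq' f₁) +
      ((((a • y : periodHomologyHecke N₂) : Module.Dual ℂ (CuspForm (Gamma0 N₂) 2)) (iota N₁ N₂ 1 2 h₁ f₁) +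
        ((a • y : periodHomologyHecke N₂) : Module.Dual ℂ (CuspForm (Gamma0 N₂) 2)) ((q : ℂ) • iota N₁ N₂ q 2 hq' f₁)) +
       (((a • y : periodHomologyHecke N₂) : Module.Dual ℂ (CuspForm (Gamma0 N₂) 2)) (iota N₁ N₂ 1 2 h₁ f₁) +
        ((a • y : periodHomologyHecke N₂) : Module.Dual ℂ (CuspForm (Gamma0 N₂) 2)) ((q : ℂ) • iota N₁ N₂ q 2 hq' f₁))) := by
    rw [add_smul, hay, Submodule.coe_add, Submodule.coe_add, LinearMap.add_apply, LinearMap.add_apply, Submodule.coe_smul,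
      HeckeRing0.smul_dual_apply, hsF, map_add, map_smul, map_smul, hFa, smul_eq_mul, smul_eq_mul]
  obtain ⟨i₁, i₂⟩ := hint y
  obtain ⟨j₁, j₂⟩ := hint (a • y)
  have hdiv : c₁ * (((s + a * 2) • y : periodHomologyHecke N₂) : Module.Dual ℂ (CuspForm (Gamma0 N₂) 2)) F₁ / 2 =
      (k₁ : ℂ) * (c₁ * (y : Module.Dual ℂ (CuspForm (Gamma0 N₂) 2)) (iota N₁ N₂ 1 2 h₁ f₁)) +
      (k₂ : ℂ) * (c₁ * (y : Module.Dual ℂ (CuspForm (Gamma0 N₂) 2)) ((q : ℂ) • iota N₁ N₂ q 2 hq' f₁)) +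
      (c₁ * ((a • y : periodHomologyHecke N₂) : Module.Dual ℂ (CuspForm (Gamma0 N₂) 2)) (iota N₁ N₂ 1 2 h₁ f₁) +
        c₁ * ((a • y : periodHomologyHecke N₂) : Module.Dual ℂ (CuspForm (Gamma0 N₂) 2)) ((q : ℂ) • iota N₁ N₂ q 2 hq' f₁)) := by
    rw [hval]; push_cast; ring
  rw [hdiv]
  refine Λ₁.add_mem (Λ₁.add_mem ?_ ?_) (Λ₁.add_mem j₁ j₂)
  · rw [← zsmul_eq_mul]; exact Λ₁.zsmul_mem i₁ _
  · rw [← zsmul_eq_mul]; exact Λ₁.zsmul_mem i₂ _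

end Row

end Summit.BirchSwinnertonDyer.BirchSwinnertonDyer.Theorems.AlignedTransportAtTwoKilfordCopyCrossLevelHecke

end
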